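import Literature.AlgebraicGeometry.HodgeTheory.BettiKunnethPieceRationalActions
import Literature.AlgebraicGeometry.HodgeTheory.BettiCorrespondenceActionHodgeType
import Literature.AlgebraicGeometry.HodgeTheory.LefschetzStandardOfHodgeConjectureSquare
import Literature.AlgebraicGeometry.HodgeTheory.KunnethComponentsDiagonalAction
import Literature.AlgebraicGeometry.HodgeTheory.AbsoluteHodgeClassesKunnethComponentsExist
import Literature.AlgebraicGeometry.HodgeTheory.KunnethComponentsOfHodgeClasses
import Literature.AlgebraicGeometry.HodgeTheory.HodgeTypeConjugation
import HarnessLib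

/-!
# Lemma 11.41 on the carriers: the Hodge classes of the Künneth summand `Hⁱ(Y;ℚ) ⊗ Hʲ(Z;ℚ)` are exactly the classes whose action `Hᵃ(Z;ℂ) → Hⁱ(Y;ℂ)` (`a = 2n − j`) is a lattice-preserving map of
# bidegree `(c − n, c − n)` (`2c = i + j`, `n = dim Z`); equivalently, the ℂ-linear maps `Hᵃ(Z;ℂ) → Hⁱ(Y;ℂ)` preserving rational classes and shifting Hodge types by `(c − n, c − n)` are the actions of the
# Hodge classes of the summand, each of exactly one («a Hodge class of `Hᵏ(X) ⊗ Hˡ(Y) ≅ Hom(H^{2n−k}(X), Hˡ(Y))` IS a morphism of Hodge structures», Voisin I §11.3.3 Lemma 11.41, p. 286)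
# (Voisin I §7.1.1, §7.3.1 Def. 7.22, §7.3.2, §11.3.3 Thm. 11.38–11.40, Lemma 11.41, pp. 285–287; Voisin II (10.7); Hatcher Prop. 3.38; Fulton App. B (5)–(6))

Family `hodge`, lane `lit-hodgefound` (Track 2 foundations library; Layers A1/A4), layer `Literature/AlgebraicGeometry/HodgeTheory`.  THEOREMS ONLY (no definition, no named fact, no instance;
D-0026 net debt `0`).  The seat's g30-#2/#9/#11/#13 identify, under the action `t ↦ (crossMap t ⊗ 1)_*`, the complex piece `Hⁱ(Y;ℂ) ⊗ Hʲ(Z;ℂ)` with `Hom_ℂ(Hᵃ(Z;ℂ), Hⁱ(Y;ℂ))` and the rational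
summand `Hⁱ(Y;ℚ) ⊗ Hʲ(Z;ℚ)` with the lattice-preserving maps (`a + j = 2 dim Z`, complex orientations); g30-#12 shows that a Hodge class acts with bidegree `(c − n, c − n)` (`2c = i + j`).  This
file closes the circle with the tree's converse (`exists_hodgeClass_corrAction_eq_smul_of_shift`: a lattice-preserving map of bidegree `(c − n, c − n)` is, up to a non-zero scalar, the action of
SOME rational class of type `(c, c)` on `Y × Z`): projecting that class to the Künneth piece `(i, j)` (the other pieces act by zero on `Hᵃ(Z;ℂ)` for degree reasons; the components of a rational
`(c,c)`-class are rational `(c,c)`-classes) and comparing with the unique rational class of the summand having the given action (g30-#13) shows that THIS class is of type `(c, c)`, i.e. a Hodge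
class of the summand.  Result: **a ℂ-linear `f : Hᵃ(Z;ℂ) → Hⁱ(Y;ℂ)` is the action of a Hodge class of `Hⁱ(Y;ℚ) ⊗ Hʲ(Z;ℚ)` iff `f` maps rational classes to rational classes, type `(p, q)` to type
`(p + c − n, q + c − n)`, and kills the types with `p + c < n` or `q + c < n`; the Hodge class is then unique** — the carrier form of Lemma 11.41 (the Hodge classes of `Hⁱ(Y) ⊗ Hʲ(Z)` are the
morphisms of Hodge structures `H^{2n−j}(Z) → Hⁱ(Y)` of bidegree `(c − n, c − n)`, i.e. `H^{2n−j}(Z) → Hⁱ(Y)(c − n)`), for every bidegree (`c < n` included, thanks to the vanishing clause).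

WHAT IS PROVED.
* §1 **`BettiUniverse.mem_hodgeClasses_kunnethSummand_iff_crossMap_mem`** (`t` is a Hodge class of the summand iff `crossMap t` is a Hodge class of `Hᵏ(Y × Z)`), **`…_iff_isOfHodgeType`** (iff `crossMap t ⊗ 1`
  is of type `(c, c)`).
* §2 (⇒) **`BettiUniverse.typeShift_corrAction_crossMap_of_mem_hodgeClasses`**: the action of a Hodge class of the summand preserves rational classes, shifts types by `(c − n, c − n)` and kills the
  types below (g30-#12/#13 repackaged).
* §3 (⇐) **`BettiUniverse.mem_hodgeClasses_of_typeShift_corrAction_crossMap`** (a class of the rational summand whose action is a lattice-preserving map of bidegree `(c − n, c − n)` is a Hodge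
  class), **`BettiUniverse.exists_mem_hodgeClasses_corrAction_crossMap_eq_of_typeShift`**, **`BettiUniverse.existsUnique_mem_hodgeClasses_corrAction_crossMap_eq_of_typeShift`**.
* §4 **`BettiUniverse.exists_mem_hodgeClasses_corrAction_crossMap_eq_iff_typeShift`** (the iff of the title).

THE PRINTS.  C. Voisin (2002) [VoisinHodgeI2002] §7.1.1; §7.3.1 Def. 7.22; §7.3.2 (7.11), Lemma 7.28; §11.1.2 Prop. 11.20; §11.3.3 Thm. 11.38–11.40, Lemma 11.41 and pp. 285–287.  C. Voisin (2003) [VoisinHodgeII2003]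
§10.2.2 proof of Thm. 10.17, (10.7).  A. Hatcher (2002) [HatcherAT2002] §3.2 Thm. 3.15, Thm. 3.16; §3.3 Prop. 3.38.  W. Fulton (1997) [FultonYoungTableaux1997] Appendix B §B.1 (5)–(6).

THE OBJECTS (all the tree's).  `corrAction complexOrientationFamily hY hZ hab`, `BettiUniverse.crossMap`, `BettiUniverse.kunnethSummand`, `BettiUniverse.kunnethMap`, `BettiUniverse.hodge hHD hX k`, `hodgeClasses`,
`kunnethPiece`, `IsOfHodgeType`, `IsRationalClass`, `ofRatClass`, `BettiUniverse.realHodgeModel`, `hodgePQ_independent_of_hodgeModel_holds`; `exists_hodgeClass_corrAction_eq_smul_of_shift`,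
`exists_sum_kunnethPiece_eq`, `isRationalClass_of_sum_kunnethPiece_eq`, `isOfHodgeType_of_sum_kunnethPiece_eq`, `corrAction_eq_zero_of_mem_kunnethPiece_of_ne`, `BettiUniverse.kunnethMap_mem_hodgeClasses_iff`,
`BettiUniverse.mem_hodgeClasses_hodge_iff_isOfHodgeType`; the seat's g30-#2 `eq_of_mem_kunnethPiece_of_corrAction_eq`, `BettiUniverse.corrAction_crossMap_injective`, g30-#12 `isOfHodgeType_corrAction`,
`corrAction_eq_zero_of_isOfHodgeType_of_lt`, g30-#13 `BettiUniverse.exists_crossMap_corrAction_eq_of_forall_isRationalClass`, `BettiUniverse.isRationalClass_corrAction_ofRatClass`.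

DEVIATIONS / SCOPE.  Complex orientations (rationality of the Gysin maps).  The morphism of Hodge structures itself (`HodgeStructure.Hom` into the Tate twist) is not constructed — the statement
is on carriers, in the tree's `IsRationalClass`/`IsOfHodgeType` vocabulary (the packaging into `Hom` is the tree's `HodgeModel.exists_hom_of_typeShift`, for non-negative bidegree).  No definitions.

## References
* [VoisinHodgeI2002] C. Voisin, *Hodge Theory and Complex Algebraic Geometry I* (2002) — §7.1.1; §7.3.1 Def. 7.22; §7.3.2 (7.11), Lemma 7.28; §11.1.2 Prop. 11.20; §11.3.3 Thm. 11.38–11.40, Lemma 11.41, pp. 285–287.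
* [VoisinHodgeII2003] C. Voisin, *Hodge Theory and Complex Algebraic Geometry II* (2003) — §10.2.2 proof of Thm. 10.17 (10.7).
* [HatcherAT2002] A. Hatcher, *Algebraic Topology* (2002) — §3.2 Thm. 3.15, Thm. 3.16; §3.3 Prop. 3.38.
* [FultonYoungTableaux1997] W. Fulton, *Young Tableaux* (1997) — Appendix B §B.1 (5)–(6).

## Provenance
Lane `lit-hodgefound` (Hodge path, Track 2), prover seat `lit-hodgefound-p29` (generation 30), self-proposed row g30-#14 (Lemma 11.41 on carriers: closes g30-#2/#9/#11/#12/#13 with the tree's converse).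
-/

noncomputable section

open scoped TensorProduct
open CategoryTheory MonoidalCategory CartesianMonoidalCategory Module Finset
open Literature.AlgebraicTopology.SingularHomology
open Literature.Geometry.Kaehler

namespace Literature.AlgebraicGeometry.HodgeTheory

open Literature.AlgebraicGeometry.Motives
open Literature.AlgebraicGeometry.Motives.HodgeStructure

variable {m n l : ℕ} {Y Z : SchemeOver ℂ}

section Summand

variable [HodgeTensorFacts.{0, 0}]

/-! ### §1 Hodge classes of the summand and of the product -/

/-- **`t ∈ Hⁱ(Y;ℚ) ⊗ Hʲ(Z;ℚ)` is a Hodge class of the Künneth summand iff `crossMap t` is a Hodge class of `Hᵏ(Y × Z)`** (the Künneth isomorphism is an isomorphism of Hodge structures: the tree's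
`BettiUniverse.kunnethMap_mem_hodgeClasses_iff` on the family supported at `(i, j)`). [cite: VoisinHodgeI2002, §11.3.3 Thm. 11.38–11.40 and p. 287] [cite: HatcherAT2002, §3.2 Thm. 3.15, Thm. 3.16] -/
theorem BettiUniverse.mem_hodgeClasses_kunnethSummand_iff_crossMap_mem (hHD : exists_isReal_hodgeModel) (hY : IsSmoothProjective m Y) (hZ : IsSmoothProjective n Z) (hYZ : IsSmoothProjective l (Y ⊗ Z))
    {i j k : ℕ} (hij : i + j = k) (p : ℤ) (t : bettiCohomology Y i ⊗[ℚ] bettiCohomology Z j) :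
    t ∈ (BettiUniverse.kunnethSummand hHD hY hZ k ⟨(i, j), mem_antidiagonal.2 hij⟩).hodgeClasses p ↔ BettiUniverse.crossMap Y Z hij t ∈ (BettiUniverse.hodge hHD hYZ k).hodgeClasses p := by
  classical
  have h := BettiUniverse.kunnethMap_mem_hodgeClasses_iff hHD hodgePQ_independent_of_hodgeModel_holds hY hZ hYZ k p (Pi.single ⟨(i, j), mem_antidiagonal.2 hij⟩ t)
  rw [BettiUniverse.kunnethMap_single] at h
  rw [h]
  refine ⟨fun ht ij ↦ ?_, fun ht ↦ by simpa using ht ⟨(i, j), mem_antidiagonal.2 hij⟩⟩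
  by_cases hij' : ij = ⟨(i, j), mem_antidiagonal.2 hij⟩
  · subst hij'
    simpa using ht
  · rw [Pi.single_eq_of_ne hij']
    exact Submodule.zero_mem _

/-- **`t` is a Hodge class of the summand `Hⁱ(Y;ℚ) ⊗ Hʲ(Z;ℚ)` (`i + j = 2c`) iff `crossMap t ⊗ 1 ∈ H^{2c}(Y × Z;ℂ)` is of Hodge type `(c, c)`.** [cite: VoisinHodgeI2002, §7.1.1, §11.3.3 Thm. 11.38–11.40 and p. 287] -/
theorem BettiUniverse.mem_hodgeClasses_kunnethSummand_iff_isOfHodgeType (hHD : exists_isReal_hodgeModel) (hY : IsSmoothProjective m Y) (hZ : IsSmoothProjective n Z) {c i j : ℕ} (hij : i + j = 2 * c)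
    (t : bettiCohomology Y i ⊗[ℚ] bettiCohomology Z j) :
    t ∈ (BettiUniverse.kunnethSummand hHD hY hZ (2 * c) ⟨(i, j), mem_antidiagonal.2 hij⟩).hodgeClasses c ↔
      IsOfHodgeType (m + n) (Y ⊗ Z) (2 * c) c c (ofRatClass (ComplexPoints (Y ⊗ Z)) (2 * c) (BettiUniverse.crossMap Y Z hij t)) := by
  rw [BettiUniverse.mem_hodgeClasses_kunnethSummand_iff_crossMap_mem hHD hY hZ (hY.tensor_holds hZ) hij c t, BettiUniverse.mem_hodgeClasses_hodge_iff_isOfHodgeType hHD (hY.tensor_holds hZ) c]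

/-! ### §2 (⇒) The action of a Hodge class of the summand is a lattice-preserving map of bidegree `(c − n, c − n)` -/

/-- **(⇒) The action `(crossMap t ⊗ 1)_* : Hᵃ(Z;ℂ) → Hⁱ(Y;ℂ)` of a Hodge class `t` of `Hⁱ(Y;ℚ) ⊗ Hʲ(Z;ℚ)` (`i + j = 2c`, `a + 2c = i + 2n`; complex orientations) maps rational classes to rational classes,
type `(p, q)` to type `(p + c − n, q + c − n)`, and kills the types with `p + c < n` or `q + c < n`** (the seat's g30-#12/#13). [cite: VoisinHodgeI2002, §7.3.2 (7.11), §11.1.2 Prop. 11.20, §11.3.3 Lemma 11.41 and p. 286]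
[cite: VoisinHodgeII2003, §10.2.2 (10.7)] -/
theorem BettiUniverse.typeShift_corrAction_crossMap_of_mem_hodgeClasses (hHD : exists_isReal_hodgeModel) (hY : IsSmoothProjective m Y) (hZ : IsSmoothProjective n Z) {c i j a : ℕ} (hij : i + j = 2 * c)
    (hab : a + 2 * c = i + 2 * n) {t : bettiCohomology Y i ⊗[ℚ] bettiCohomology Z j} (ht : t ∈ (BettiUniverse.kunnethSummand hHD hY hZ (2 * c) ⟨(i, j), mem_antidiagonal.2 hij⟩).hodgeClasses c) :
    (∀ u, IsRationalClass u → IsRationalClass (corrAction complexOrientationFamily hY hZ hab (ofRatClass (ComplexPoints (Y ⊗ Z)) (2 * c) (BettiUniverse.crossMap Y Z hij t)) u)) ∧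
    (∀ (p q : ℕ) (u : complexBetti Z a), IsOfHodgeType n Z a p q u → ∀ p' q' : ℕ, p' + n = p + c → q' + n = q + c →
      IsOfHodgeType m Y i p' q' (corrAction complexOrientationFamily hY hZ hab (ofRatClass (ComplexPoints (Y ⊗ Z)) (2 * c) (BettiUniverse.crossMap Y Z hij t)) u)) ∧
    (∀ (p q : ℕ) (u : complexBetti Z a), IsOfHodgeType n Z a p q u → p + c < n ∨ q + c < n →
      corrAction complexOrientationFamily hY hZ hab (ofRatClass (ComplexPoints (Y ⊗ Z)) (2 * c) (BettiUniverse.crossMap Y Z hij t)) u = 0) := by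
  have hγ := (BettiUniverse.mem_hodgeClasses_kunnethSummand_iff_isOfHodgeType hHD hY hZ hij t).1 ht
  exact ⟨fun u hu ↦ BettiUniverse.isRationalClass_corrAction_ofRatClass hY hZ hab _ hu,
    fun p q u hu p' q' hp hq ↦ isOfHodgeType_corrAction complexOrientationFamily hHD hY hZ hab hγ hp hq hu,
    fun p q u hu hlt ↦ corrAction_eq_zero_of_isOfHodgeType_of_lt hHD hY hZ hab hγ hlt hu⟩

end Summand

/-! ### §3 (⇐) A lattice-preserving map of bidegree `(c − n, c − n)` is the action of a unique Hodge class of the summand -/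

section Converse

variable [HodgeTensorFacts.{0, 0}]

/-- **(⇐, on a class of the summand) A class `t ∈ Hⁱ(Y;ℚ) ⊗ Hʲ(Z;ℚ)` (`i + j = 2c`, `a + j = 2 dim Z`) whose action `(crossMap t ⊗ 1)_* : Hᵃ(Z;ℂ) → Hⁱ(Y;ℂ)` shifts Hodge types by `(c − n, c − n)` (and kills the
types below) IS a Hodge class of the summand.**  Proof: the action preserves rational classes (g30-#13), so by the tree's converse there is a rational class `γ` of type `(c, c)` on `Y × Z` with
`γ_* = t₀ • (crossMap t ⊗ 1)_*`, `t₀ ≠ 0`; its Künneth component `π` in the piece `(i, j)` is of type `(c, c)` and has the same action on `Hᵃ(Z;ℂ)` (the other pieces act by zero there), so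
`π = t₀ • (crossMap t ⊗ 1)` by the injectivity of the action on the piece (g30-#2), and `crossMap t ⊗ 1 = t₀⁻¹ • π` is of type `(c, c)`. [cite: VoisinHodgeI2002, §7.3.1 Def. 7.22, §11.3.3 Thm. 11.38–11.40, Lemma 11.41 and pp. 285–287]
[cite: HatcherAT2002, §3.3 Prop. 3.38] -/
theorem BettiUniverse.mem_hodgeClasses_of_typeShift_corrAction_crossMap (hHD : exists_isReal_hodgeModel) (hY : IsSmoothProjective m Y) (hZ : IsSmoothProjective n Z) {c i j a : ℕ} (hij : i + j = 2 * c)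
    (haj : a + j = 2 * n) (hab : a + 2 * c = i + 2 * n) (t : bettiCohomology Y i ⊗[ℚ] bettiCohomology Z j)
    (hS : ∀ (p q : ℕ), p + q = a → ∀ u : complexBetti Z a, IsOfHodgeType n Z a p q u → ∀ p' q' : ℕ, p' + n = p + c → q' + n = q + c →
      IsOfHodgeType m Y i p' q' (corrAction complexOrientationFamily hY hZ hab (ofRatClass (ComplexPoints (Y ⊗ Z)) (2 * c) (BettiUniverse.crossMap Y Z hij t)) u))
    (hV : ∀ (p q : ℕ), p + q = a → ∀ u : complexBetti Z a, IsOfHodgeType n Z a p q u → p + c < n ∨ q + c < n →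
      corrAction complexOrientationFamily hY hZ hab (ofRatClass (ComplexPoints (Y ⊗ Z)) (2 * c) (BettiUniverse.crossMap Y Z hij t)) u = 0) :
    t ∈ (BettiUniverse.kunnethSummand hHD hY hZ (2 * c) ⟨(i, j), mem_antidiagonal.2 hij⟩).hodgeClasses c := by
  classical
  have hI := hodgePQ_independent_of_hodgeModel_holds
  set f := corrAction complexOrientationFamily hY hZ hab (ofRatClass (ComplexPoints (Y ⊗ Z)) (2 * c) (BettiUniverse.crossMap Y Z hij t)) with hf
  -- the tree's converse: a rational `(c,c)`-class `γ` on `Y × Z` with `γ_* = t₀ • f`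
  let A : HodgeModel m Y := BettiUniverse.realHodgeModel hHD hY
  let B : HodgeModel n Z := BettiUniverse.realHodgeModel hHD hZ
  have hR : ∀ u, IsRationalClass u → IsRationalClass (f u) := fun u hu ↦ BettiUniverse.isRationalClass_corrAction_ofRatClass hY hZ hab _ hu
  have hφH : ∀ (p q : ℕ), p + q = a → ∀ u, B.pullback a u ∈ B.hodgePQ a p q → ∀ (p' q' : ℕ), p' + n = p + c → q' + n = q + c → A.pullback i (f u) ∈ A.hodgePQ i p' q' := by
    intro p q hpq u hu p' q' hp hq
    obtain ⟨A', hA'⟩ := hS p q hpq u ⟨B, hu⟩ p' q' hp hq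
    exact hI m Y hY A' A i p' q' _ hA'
  have hφ0 : ∀ (p q : ℕ), p + q = a → ∀ u, B.pullback a u ∈ B.hodgePQ a p q → (p + c < n ∨ q + c < n) → f u = 0 :=
    fun p q hpq u hu hlt ↦ hV p q hpq u ⟨B, hu⟩ hlt
  obtain ⟨γ, hγrat, hγtype, t₀, ht₀, hact⟩ := exists_hodgeClass_corrAction_eq_smul_of_shift hY hZ A B hab f hR hφH hφ0 complexOrientationFamily
  -- the Künneth component of `γ` in the piece `(i, j)`
  obtain ⟨π, hπ, hsum⟩ := exists_sum_kunnethPiece_eq hY hZ (2 * c) γ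
  obtain rfl : i = 2 * c - j := by omega
  let j₀ : Fin (2 * c + 1) := ⟨j, by omega⟩
  have hπtype : IsOfHodgeType (m + n) (Y ⊗ Z) (2 * c) c c (π j₀) := isOfHodgeType_of_sum_kunnethPiece_eq hY hZ hπ hγrat hγtype hsum j₀
  have hπmem : π j₀ ∈ kunnethPiece Y Z hij := hπ j₀
  -- the other components act by zero on `Hᵃ(Z;ℂ)`
  have hπact : corrAction complexOrientationFamily hY hZ hab (π j₀) = t₀ • f := by
    rw [← hact, ← hsum, map_sum, Finset.sum_eq_single j₀ (fun j' _ hne ↦ ?_) (fun h ↦ (h (Finset.mem_univ _)).elim)]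
    refine corrAction_eq_zero_of_mem_kunnethPiece_of_ne complexOrientationFamily hY hZ _ (hπ j') hab fun h ↦ hne (Fin.ext ?_)
    change (j' : ℕ) = j
    omega
  -- hence `π = t₀ • (crossMap t ⊗ 1)` and `crossMap t ⊗ 1` is of type `(c, c)`
  have hmem : t₀ • ofRatClass (ComplexPoints (Y ⊗ Z)) (2 * c) (BettiUniverse.crossMap Y Z hij t) ∈ kunnethPiece Y Z hij :=
    Submodule.smul_mem _ _ (ofRatClass_crossMap_mem_kunnethPiece hij t)
  have hπeq : π j₀ = t₀ • ofRatClass (ComplexPoints (Y ⊗ Z)) (2 * c) (BettiUniverse.crossMap Y Z hij t) :=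
    eq_of_mem_kunnethPiece_of_corrAction_eq complexOrientationFamily hY hZ hij haj hab hπmem hmem (by rw [hπact, map_smul])
  have hcl : ofRatClass (ComplexPoints (Y ⊗ Z)) (2 * c) (BettiUniverse.crossMap Y Z hij t) = t₀⁻¹ • π j₀ := by
    rw [hπeq, smul_smul, inv_mul_cancel₀ ht₀, one_smul]
  rw [BettiUniverse.mem_hodgeClasses_kunnethSummand_iff_isOfHodgeType hHD hY hZ hij t, hcl]
  exact hπtype.smul _

/-- **(⇐) A ℂ-linear `f : Hᵃ(Z;ℂ) → Hⁱ(Y;ℂ)` mapping rational classes to rational classes, type `(p, q)` to type `(p + c − n, q + c − n)`, and killing the types with `p + c < n` or `q + c < n`, is the action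
`(crossMap t ⊗ 1)_*` of a Hodge class `t` of `Hⁱ(Y;ℚ) ⊗ Hʲ(Z;ℚ)`** (`i + j = 2c`, `a + j = 2 dim Z`; complex orientations): the rational class of the summand with action `f` (g30-#13) is a Hodge class
by the previous theorem. [cite: VoisinHodgeI2002, §7.3.1 Def. 7.22, §11.3.3 Lemma 11.41 and pp. 285–287] [cite: HatcherAT2002, §3.3 Prop. 3.38] -/
theorem BettiUniverse.exists_mem_hodgeClasses_corrAction_crossMap_eq_of_typeShift (hHD : exists_isReal_hodgeModel) (hY : IsSmoothProjective m Y) (hZ : IsSmoothProjective n Z) {c i j a : ℕ}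
    (hij : i + j = 2 * c) (haj : a + j = 2 * n) (hab : a + 2 * c = i + 2 * n) (f : complexBetti Z a →ₗ[ℂ] complexBetti Y i) (hR : ∀ u, IsRationalClass u → IsRationalClass (f u))
    (hS : ∀ (p q : ℕ), p + q = a → ∀ u : complexBetti Z a, IsOfHodgeType n Z a p q u → ∀ p' q' : ℕ, p' + n = p + c → q' + n = q + c → IsOfHodgeType m Y i p' q' (f u))
    (hV : ∀ (p q : ℕ), p + q = a → ∀ u : complexBetti Z a, IsOfHodgeType n Z a p q u → p + c < n ∨ q + c < n → f u = 0) :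
    ∃ t ∈ (BettiUniverse.kunnethSummand hHD hY hZ (2 * c) ⟨(i, j), mem_antidiagonal.2 hij⟩).hodgeClasses c,
      corrAction complexOrientationFamily hY hZ hab (ofRatClass (ComplexPoints (Y ⊗ Z)) (2 * c) (BettiUniverse.crossMap Y Z hij t)) = f := by
  obtain ⟨t, ht⟩ := BettiUniverse.exists_crossMap_corrAction_eq_of_forall_isRationalClass hY hZ hij haj hab f hR
  refine ⟨t, BettiUniverse.mem_hodgeClasses_of_typeShift_corrAction_crossMap hHD hY hZ hij haj hab t ?_ ?_, ht⟩
  · rw [ht]; exact hS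
  · rw [ht]; exact hV

/-- **… and the Hodge class is unique** (a class of the summand is determined by its action, g30-#2). [cite: VoisinHodgeI2002, §11.3.3 Lemma 11.41 and p. 286] -/
theorem BettiUniverse.existsUnique_mem_hodgeClasses_corrAction_crossMap_eq_of_typeShift (hHD : exists_isReal_hodgeModel) (hY : IsSmoothProjective m Y) (hZ : IsSmoothProjective n Z) {c i j a : ℕ}
    (hij : i + j = 2 * c) (haj : a + j = 2 * n) (hab : a + 2 * c = i + 2 * n) (f : complexBetti Z a →ₗ[ℂ] complexBetti Y i) (hR : ∀ u, IsRationalClass u → IsRationalClass (f u))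
    (hS : ∀ (p q : ℕ), p + q = a → ∀ u : complexBetti Z a, IsOfHodgeType n Z a p q u → ∀ p' q' : ℕ, p' + n = p + c → q' + n = q + c → IsOfHodgeType m Y i p' q' (f u))
    (hV : ∀ (p q : ℕ), p + q = a → ∀ u : complexBetti Z a, IsOfHodgeType n Z a p q u → p + c < n ∨ q + c < n → f u = 0) :
    ∃! t, t ∈ (BettiUniverse.kunnethSummand hHD hY hZ (2 * c) ⟨(i, j), mem_antidiagonal.2 hij⟩).hodgeClasses c ∧
      corrAction complexOrientationFamily hY hZ hab (ofRatClass (ComplexPoints (Y ⊗ Z)) (2 * c) (BettiUniverse.crossMap Y Z hij t)) = f := by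
  obtain ⟨t, ht, htf⟩ := BettiUniverse.exists_mem_hodgeClasses_corrAction_crossMap_eq_of_typeShift hHD hY hZ hij haj hab f hR hS hV
  refine ⟨t, ⟨ht, htf⟩, fun t' ht' ↦ BettiUniverse.corrAction_crossMap_injective complexOrientationFamily hY hZ hij haj hab ?_⟩
  change corrAction complexOrientationFamily hY hZ hab (ofRatClass (ComplexPoints (Y ⊗ Z)) (2 * c) (BettiUniverse.crossMap Y Z hij t')) =
    corrAction complexOrientationFamily hY hZ hab (ofRatClass (ComplexPoints (Y ⊗ Z)) (2 * c) (BettiUniverse.crossMap Y Z hij t))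
  rw [htf, ht'.2]

/-! ### §4 The iff -/

/-- **Lemma 11.41 on the carriers.**  For smooth projective `Y`, `Z` (`dim Z = n`), `i + j = 2c`, `a + j = 2n` and a ℂ-linear `f : Hᵃ(Z;ℂ) → Hⁱ(Y;ℂ)`, the following are equivalent: (i) `f = (crossMap t ⊗ 1)_*` for a
Hodge class `t` of the Künneth summand `Hⁱ(Y;ℚ) ⊗ Hʲ(Z;ℚ)`; (ii) `f` maps rational classes to rational classes, classes of type `(p, q)` (`p + q = a`) to classes of type `(p + c − n, q + c − n)`, and
kills those with `p + c < n` or `q + c < n` — i.e. `f` is (the complexification of) a morphism of Hodge structures `Hᵃ(Z) → Hⁱ(Y)` of bidegree `(c − n, c − n)` (complex orientations).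
[cite: VoisinHodgeI2002, §7.3.1 Def. 7.22, §11.3.3 Thm. 11.38–11.40, Lemma 11.41 and pp. 285–287] [cite: VoisinHodgeII2003, §10.2.2 (10.7)] [cite: HatcherAT2002, §3.3 Prop. 3.38] -/
theorem BettiUniverse.exists_mem_hodgeClasses_corrAction_crossMap_eq_iff_typeShift (hHD : exists_isReal_hodgeModel) (hY : IsSmoothProjective m Y) (hZ : IsSmoothProjective n Z) {c i j a : ℕ}
    (hij : i + j = 2 * c) (haj : a + j = 2 * n) (hab : a + 2 * c = i + 2 * n) (f : complexBetti Z a →ₗ[ℂ] complexBetti Y i) :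
    (∃ t ∈ (BettiUniverse.kunnethSummand hHD hY hZ (2 * c) ⟨(i, j), mem_antidiagonal.2 hij⟩).hodgeClasses c,
        corrAction complexOrientationFamily hY hZ hab (ofRatClass (ComplexPoints (Y ⊗ Z)) (2 * c) (BettiUniverse.crossMap Y Z hij t)) = f) ↔
      (∀ u, IsRationalClass u → IsRationalClass (f u)) ∧
      (∀ (p q : ℕ), p + q = a → ∀ u : complexBetti Z a, IsOfHodgeType n Z a p q u → ∀ p' q' : ℕ, p' + n = p + c → q' + n = q + c → IsOfHodgeType m Y i p' q' (f u)) ∧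
      (∀ (p q : ℕ), p + q = a → ∀ u : complexBetti Z a, IsOfHodgeType n Z a p q u → p + c < n ∨ q + c < n → f u = 0) := by
  refine ⟨?_, fun h ↦ BettiUniverse.exists_mem_hodgeClasses_corrAction_crossMap_eq_of_typeShift hHD hY hZ hij haj hab f h.1 h.2.1 h.2.2⟩
  rintro ⟨t, ht, rfl⟩
  obtain ⟨hR, hS, hV⟩ := BettiUniverse.typeShift_corrAction_crossMap_of_mem_hodgeClasses hHD hY hZ hij hab ht
  exact ⟨hR, fun p q _ u hu p' q' hp hq ↦ hS p q u hu p' q' hp hq, fun p q _ u hu hlt ↦ hV p q u hu hlt⟩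

end Converse

end Literature.AlgebraicGeometry.HodgeTheory

end
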